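import Literature.Analysis.Fourier.WirtingerDirichlet
import HarnessLib

/-!
# Wirtinger's inequality with ONE Dirichlet end: `∫₀^π y² ≤ 4∫₀^π y′²` for `y(0) = 0`, `y′ ∈ L²`

Topic `Literature/Analysis/Fourier` (companion of `WirtingerDirichlet.lean`). Hardy–Littlewood–Pólya, *Inequalities*, Theorem 256 with
`k = 1` (constant `C = (2/π)²` on `(0, 1)`), equivalently §7.7 eqs. (7.7.1)–(7.7.2): «`∫₀^{π/2} y² < ∫₀^{π/2} y′²` if `y(0) = 0` and `y`
is not a multiple of `sin x`», through the identity `∫(y′² − y²) = ∫(y′ − y cot x)²` on `(0, π/2)`. Scaled to `(0, π)` the weight is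
`½cot(θ/2)` and the constant is `4` (first eigenvalue `¼` of the mixed Dirichlet–Neumann problem; extremal `sin(θ/2)`):

  `F(0) = 0`, `F` continuous and bounded on `[0, π)`, `F′ = f` continuous on `(0, π)`, `f, f² ∈ L¹(0, π)`  ⇒  `∫₀^π F² ≤ 4·∫₀^π f²`

(`integral_sq_le_four_mul_integral_deriv_sq`). NO condition at `θ = π` is needed — the boundary term `½F²cot(θ/2)` has the
favourable sign there — and `F` need not even have a limit at `π` (only boundedness, for `F²` to be integrable). Proof as in the
Dirichlet file: `f² = ¼F² + (f − ½F cot(θ/2))² + (½F² cot(θ/2))′` on `[a, b] ⊂ (0, π)`, `½F(a)²cot(a/2) ≤ ∫₀^a f²` by Schwarz and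
`(a/2)cot(a/2) ≤ 1`, then `a → 0`, `b → π`. [cite: HardyLittlewoodPolya1952, Thm. 256 (k = 1) and eqs. (7.7.1)–(7.7.2)]
MOTIVATION (cell ns-blowup, zone Z3, case Z3-SR-CERT): with `F(θ) = 𝒰δ(L tan(θ/2))` this is the UNCONDITIONAL form
`‖𝒰δ‖_{L²(dθ)} ≤ 2(2L)^{-1/2}‖Hδ‖_w` («Volterra-sharp» high-pass constant `D = 2.63429` of record, RULING (dz)); the Dirichlet file gives
the constant `1` under the extra endpoint condition `𝒰δ(±∞) = 0`. No definition.
-/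

noncomputable section

namespace Literature.Analysis.Fourier

open _root_.MeasureTheory _root_.Set _root_.Filter _root_.Real intervalIntegral
open scoped Real Topology

/-- Schwarz against `1`: `(∫_a^b f)² ≤ (b − a)·∫_a^b f²` (`a ≤ b`) (helper, as in `WirtingerDirichlet`). [folklore] -/
private theorem sq_integral_le_mul_integral_sq_aux' {f : ℝ → ℝ} {a b : ℝ} (hab : a ≤ b) (hf : IntervalIntegrable f volume a b)
    (hf2 : IntervalIntegrable (fun x => f x ^ 2) volume a b) :
    (∫ x in a..b, f x) ^ 2 ≤ (b - a) * ∫ x in a..b, f x ^ 2 := by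
  rcases hab.eq_or_lt with h | h
  · subst h; simp
  have hba : 0 < b - a := sub_pos.2 h
  set I := ∫ x in a..b, f x with hI
  set m := I / (b - a) with hm
  have hfm : IntervalIntegrable (fun x => m * f x) volume a b := hf.const_mul m
  have hkey : 0 ≤ ∫ x in a..b, (f x - m) ^ 2 :=
    intervalIntegral.integral_nonneg h.le fun x _ => sq_nonneg _
  have hexp : ∫ x in a..b, (f x - m) ^ 2 = (∫ x in a..b, f x ^ 2) - 2 * m * I + m ^ 2 * (b - a) := by
    have e : (fun x => (f x - m) ^ 2) = fun x => f x ^ 2 - 2 * (m * f x) + m ^ 2 := by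
      funext x; ring
    rw [e, intervalIntegral.integral_add (hf2.sub (hfm.const_mul 2)) intervalIntegrable_const,
      intervalIntegral.integral_sub hf2 (hfm.const_mul 2), intervalIntegral.integral_const_mul,
      intervalIntegral.integral_const_mul, intervalIntegral.integral_const, smul_eq_mul, hI]
    ring
  rw [hexp, hm] at hkey
  have : 0 ≤ (∫ x in a..b, f x ^ 2) - I ^ 2 / (b - a) := by
    have e : (∫ x in a..b, f x ^ 2) - 2 * (I / (b - a)) * I + (I / (b - a)) ^ 2 * (b - a) =
        (∫ x in a..b, f x ^ 2) - I ^ 2 / (b - a) := by field_simp; ring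
    linarith [e]
  rw [sub_nonneg, div_le_iff₀ hba] at this
  linarith

/-- `a·cos a ≤ sin a` for `0 ≤ a < π/2` (helper). [folklore] -/
private theorem mul_cos_le_sin_aux' {a : ℝ} (h0 : 0 ≤ a) (h1 : a < π / 2) : a * Real.cos a ≤ Real.sin a := by
  have hc : 0 < Real.cos a := Real.cos_pos_of_mem_Ioo ⟨by linarith, h1⟩
  have ht : a ≤ Real.tan a := Real.le_tan h0 h1
  rw [Real.tan_eq_sin_div_cos, le_div_iff₀ hc] at ht
  exact ht

/-- The completed square with the half-angle weight on `[a, b] ⊂ (0, π)`: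
`¼∫_a^b F² ≤ ∫_a^b f² − ½F(b)²cot(b/2) + ½F(a)²cot(a/2)` (`f = F′`; from `f² = ¼F² + (f − ½F cot(θ/2))² + (½F²cot(θ/2))′`).
[cite: HardyLittlewoodPolya1952, §7.7 eq. (7.7.2)] -/
theorem integral_sq_le_four_mul_core {F f : ℝ → ℝ} {a b : ℝ} (ha : 0 < a) (hab : a ≤ b) (hb : b < π)
    (hF : ∀ θ ∈ Icc a b, HasDerivAt F (f θ) θ) (hfc : ContinuousOn f (Icc a b)) :
    (1 / 4) * ∫ θ in a..b, F θ ^ 2 ≤ (∫ θ in a..b, f θ ^ 2) - (1 / 2) * F b ^ 2 * (Real.cos (b / 2) / Real.sin (b / 2)) +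
      (1 / 2) * F a ^ 2 * (Real.cos (a / 2) / Real.sin (a / 2)) := by
  have hsin : ∀ θ ∈ Icc a b, 0 < Real.sin (θ / 2) := fun θ hθ =>
    Real.sin_pos_of_pos_of_lt_pi (by linarith [hθ.1]) (by linarith [hθ.2])
  have hFc : ContinuousOn F (Icc a b) := fun θ hθ => (hF θ hθ).continuousAt.continuousWithinAt
  set g : ℝ → ℝ := fun θ => F θ * f θ * (Real.cos (θ / 2) / Real.sin (θ / 2)) - (1 / 4) * F θ ^ 2 / Real.sin (θ / 2) ^ 2
    with hg
  have hG : ∀ θ ∈ uIcc a b, HasDerivAt (fun θ => (1 / 2) * F θ ^ 2 * (Real.cos (θ / 2) / Real.sin (θ / 2))) (g θ) θ := by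
    intro θ hθ
    rw [uIcc_of_le hab] at hθ
    have hs := (hsin θ hθ).ne'
    have hhalf : HasDerivAt (fun θ : ℝ => θ / 2) (1 / 2) θ := by simpa using (hasDerivAt_id θ).div_const 2
    have hcot : HasDerivAt (fun θ => Real.cos (θ / 2) / Real.sin (θ / 2)) (-(1 / 2) / Real.sin (θ / 2) ^ 2) θ := by
      have h := (hhalf.cos).div (hhalf.sin) hs
      refine h.congr_deriv ?_
      field_simp
      nlinarith [Real.sin_sq_add_cos_sq (θ / 2)]
    have h := (((hF θ hθ).fun_pow 2).const_mul (1 / 2 : ℝ)).fun_mul hcot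
    refine h.congr_deriv ?_
    simp only [hg]
    push_cast
    field_simp
    ring
  have hcotc : ContinuousOn (fun θ => Real.cos (θ / 2) / Real.sin (θ / 2)) (Icc a b) :=
    (Real.continuous_cos.comp (continuous_id.div_const 2)).continuousOn.div
      (Real.continuous_sin.comp (continuous_id.div_const 2)).continuousOn fun θ hθ => (hsin θ hθ).ne'
  have hsinc : ContinuousOn (fun θ => Real.sin (θ / 2)) (Icc a b) :=
    (Real.continuous_sin.comp (continuous_id.div_const 2)).continuousOn
  have hgc : ContinuousOn g (uIcc a b) := by
    rw [uIcc_of_le hab]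
    refine (((hFc.mul hfc).mul hcotc).sub ((continuousOn_const.mul (hFc.pow 2)).div (hsinc.pow 2) fun θ hθ => ?_))
    exact pow_ne_zero 2 (hsin θ hθ).ne'
  have hFTC := intervalIntegral.integral_eq_sub_of_hasDerivAt hG (hgc.intervalIntegrable)
  have hpt : ∀ θ ∈ Icc a b, f θ ^ 2 =
      (1 / 4) * F θ ^ 2 + (f θ - (1 / 2) * F θ * (Real.cos (θ / 2) / Real.sin (θ / 2))) ^ 2 + g θ := by
    intro θ hθ
    have hs := (hsin θ hθ).ne'
    simp only [hg]
    field_simp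
    nlinarith [Real.sin_sq_add_cos_sq (θ / 2)]
  have hIF2 : IntervalIntegrable (fun θ => F θ ^ 2) volume a b := by
    rw [← uIcc_of_le hab] at hFc; exact (hFc.pow 2).intervalIntegrable
  have hIsq : IntervalIntegrable (fun θ => (f θ - (1 / 2) * F θ * (Real.cos (θ / 2) / Real.sin (θ / 2))) ^ 2) volume a b := by
    rw [← uIcc_of_le hab] at hfc hFc hcotc
    exact ((hfc.sub ((continuousOn_const.mul hFc).mul hcotc)).pow 2).intervalIntegrable
  have heq : ∫ θ in a..b, f θ ^ 2 = (∫ θ in a..b, (1 / 4) * F θ ^ 2) +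
      (∫ θ in a..b, (f θ - (1 / 2) * F θ * (Real.cos (θ / 2) / Real.sin (θ / 2))) ^ 2) + ∫ θ in a..b, g θ := by
    rw [← intervalIntegral.integral_add (hIF2.const_mul _) hIsq,
      ← intervalIntegral.integral_add ((hIF2.const_mul _).add hIsq) hgc.intervalIntegrable]
    refine intervalIntegral.integral_congr fun θ hθ => ?_
    rw [uIcc_of_le hab] at hθ
    exact hpt θ hθ
  have hnn : 0 ≤ ∫ θ in a..b, (f θ - (1 / 2) * F θ * (Real.cos (θ / 2) / Real.sin (θ / 2))) ^ 2 :=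
    intervalIntegral.integral_nonneg hab fun θ _ => sq_nonneg _
  rw [intervalIntegral.integral_const_mul] at heq
  rw [heq, hFTC]
  linarith

/-- **Wirtinger with one Dirichlet end** (Hardy–Littlewood–Pólya Thm 256, `k = 1`, scaled to `(0, π)`): `F` continuous and bounded on
`[0, π)`, differentiable on `(0, π)` with derivative `f` continuous there, `f, f² ∈ L¹(0, π)`, `F(0) = 0` ⇒ `∫₀^π F² ≤ 4·∫₀^π f²`.
No hypothesis at `θ = π`. [cite: HardyLittlewoodPolya1952, Thm. 256 (k = 1)] -/
theorem integral_sq_le_four_mul_integral_deriv_sq {F f : ℝ → ℝ} (hF : ∀ θ ∈ Ioo 0 π, HasDerivAt F (f θ) θ)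
    (hFc : ContinuousOn F (Ico 0 π)) (hFb : ∃ M, ∀ θ ∈ Ico 0 π, |F θ| ≤ M) (hfc : ContinuousOn f (Ioo 0 π))
    (hf1 : IntervalIntegrable f volume 0 π) (hf2 : IntervalIntegrable (fun θ => f θ ^ 2) volume 0 π) (hF0 : F 0 = 0) :
    ∫ θ in (0:ℝ)..π, F θ ^ 2 ≤ 4 * ∫ θ in (0:ℝ)..π, f θ ^ 2 := by
  have hπ : 0 < π := Real.pi_pos
  obtain ⟨M, hM⟩ := hFb
  have hM0 : 0 ≤ M := le_trans (abs_nonneg _) (hM 0 ⟨le_rfl, hπ⟩)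
  have hsub1 : ∀ {c d : ℝ}, 0 ≤ c → c ≤ d → d ≤ π → IntervalIntegrable f volume c d := fun hc hcd hd =>
    hf1.mono_set (by rw [uIcc_of_le hπ.le, uIcc_of_le hcd]; exact Icc_subset_Icc hc hd)
  have hsub2 : ∀ {c d : ℝ}, 0 ≤ c → c ≤ d → d ≤ π → IntervalIntegrable (fun θ => f θ ^ 2) volume c d :=
    fun hc hcd hd => hf2.mono_set (by rw [uIcc_of_le hπ.le, uIcc_of_le hcd]; exact Icc_subset_Icc hc hd)
  -- (A) left endpoint: `½F(a)²cot(a/2) ≤ ∫₀^a f²` for `0 < a < π`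
  have hA : ∀ a, 0 < a → a < π →
      (1 / 2) * F a ^ 2 * (Real.cos (a / 2) / Real.sin (a / 2)) ≤ ∫ θ in (0:ℝ)..a, f θ ^ 2 := by
    intro a ha0 ha1
    have hsa : 0 < Real.sin (a / 2) := Real.sin_pos_of_pos_of_lt_pi (by linarith) (by linarith)
    have hFa : F a = ∫ θ in (0:ℝ)..a, f θ := by
      have h := intervalIntegral.integral_eq_sub_of_hasDerivAt_of_le ha0.le
        (hFc.mono (Icc_subset_Ico_right ha1)) (fun θ hθ => hF θ ⟨hθ.1, by linarith [hθ.2]⟩) (hsub1 le_rfl ha0.le ha1.le)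
      rw [h, hF0, sub_zero]
    have hcs := sq_integral_le_mul_integral_sq_aux' ha0.le (hsub1 le_rfl ha0.le ha1.le) (hsub2 le_rfl ha0.le ha1.le)
    rw [sub_zero] at hcs
    have hI : 0 ≤ ∫ θ in (0:ℝ)..a, f θ ^ 2 := intervalIntegral.integral_nonneg ha0.le fun θ _ => sq_nonneg _
    have hcot : (a / 2) * (Real.cos (a / 2) / Real.sin (a / 2)) ≤ 1 := by
      rw [← mul_div_assoc, div_le_one hsa]; exact mul_cos_le_sin_aux' (by linarith) (by linarith)
    have hcot0 : 0 ≤ Real.cos (a / 2) / Real.sin (a / 2) :=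
      div_nonneg (Real.cos_nonneg_of_mem_Icc ⟨by linarith, by linarith⟩) hsa.le
    calc (1 / 2) * F a ^ 2 * (Real.cos (a / 2) / Real.sin (a / 2))
        ≤ (1 / 2) * (a * ∫ θ in (0:ℝ)..a, f θ ^ 2) * (Real.cos (a / 2) / Real.sin (a / 2)) := by
          rw [hFa]; exact mul_le_mul_of_nonneg_right (mul_le_mul_of_nonneg_left hcs (by norm_num)) hcot0
      _ = ((a / 2) * (Real.cos (a / 2) / Real.sin (a / 2))) * ∫ θ in (0:ℝ)..a, f θ ^ 2 := by ring
      _ ≤ 1 * ∫ θ in (0:ℝ)..a, f θ ^ 2 := mul_le_mul_of_nonneg_right hcot hI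
      _ = _ := one_mul _
  -- (C) for `0 < a ≤ b < π`: `¼∫_a^b F² ≤ ∫₀^π f²` (the right boundary term has the favourable sign)
  have hC : ∀ a b, 0 < a → a ≤ b → b < π → (1 / 4) * ∫ θ in a..b, F θ ^ 2 ≤ ∫ θ in (0:ℝ)..π, f θ ^ 2 := by
    intro a b ha0 hab hb1
    have hcore := integral_sq_le_four_mul_core ha0 hab hb1
      (fun θ hθ => hF θ ⟨by linarith [hθ.1], by linarith [hθ.2]⟩)
      (hfc.mono fun θ hθ => ⟨by linarith [hθ.1], by linarith [hθ.2]⟩)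
    have hsb : 0 < Real.sin (b / 2) := Real.sin_pos_of_pos_of_lt_pi (by linarith) (by linarith)
    have hbterm : 0 ≤ (1 / 2) * F b ^ 2 * (Real.cos (b / 2) / Real.sin (b / 2)) := by
      have : 0 ≤ Real.cos (b / 2) / Real.sin (b / 2) :=
        div_nonneg (Real.cos_nonneg_of_mem_Icc ⟨by linarith, by linarith⟩) hsb.le
      positivity
    have hsplit : ∫ θ in (0:ℝ)..π, f θ ^ 2 =
        (∫ θ in (0:ℝ)..a, f θ ^ 2) + (∫ θ in a..b, f θ ^ 2) + ∫ θ in b..π, f θ ^ 2 := by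
      rw [intervalIntegral.integral_add_adjacent_intervals (hsub2 le_rfl ha0.le (by linarith)) (hsub2 ha0.le hab hb1.le),
        intervalIntegral.integral_add_adjacent_intervals (hsub2 le_rfl (by linarith) hb1.le) (hsub2 (by linarith) hb1.le le_rfl)]
    have h3 : 0 ≤ ∫ θ in b..π, f θ ^ 2 := intervalIntegral.integral_nonneg hb1.le fun θ _ => sq_nonneg _
    linarith [hA a ha0 (by linarith)]
  -- (D) `a → 0`, `b → π`, using boundedness of `F`
  have hF2on : IntegrableOn (fun θ => F θ ^ 2) (Ioo 0 π) := by
    have hmeas : AEStronglyMeasurable (fun θ => F θ ^ 2) (volume.restrict (Ioo 0 π)) :=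
      ((hFc.pow 2).mono Ioo_subset_Ico_self).aestronglyMeasurable measurableSet_Ioo
    refine Integrable.mono' (integrableOn_const (by simp) (C := M ^ 2)) hmeas (ae_restrict_of_forall_mem measurableSet_Ioo ?_)
    intro θ hθ
    rw [Real.norm_eq_abs, abs_of_nonneg (sq_nonneg _), ← sq_abs]
    exact pow_le_pow_left₀ (abs_nonneg _) (hM θ ⟨hθ.1.le, hθ.2⟩) 2
  have hF2 : IntervalIntegrable (fun θ => F θ ^ 2) volume 0 π := by
    rw [intervalIntegrable_iff_integrableOn_Ioo_of_le hπ.le]; exact hF2on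
  have hF2sub : ∀ {c d : ℝ}, 0 ≤ c → c ≤ d → d ≤ π → IntervalIntegrable (fun θ => F θ ^ 2) volume c d :=
    fun hc hcd hd => hF2.mono_set (by rw [uIcc_of_le hπ.le, uIcc_of_le hcd]; exact Icc_subset_Icc hc hd)
  have hsmall : ∀ {c d : ℝ}, 0 ≤ c → c ≤ d → d ≤ π → ∫ θ in c..d, F θ ^ 2 ≤ M ^ 2 * (d - c) := by
    intro c d hc hcd hd
    rw [intervalIntegral.integral_of_le hcd, integral_Ioc_eq_integral_Ioo]
    have hint : IntegrableOn (fun θ => F θ ^ 2) (Ioo c d) := hF2on.mono_set (Ioo_subset_Ioo hc hd)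
    calc ∫ θ in Ioo c d, F θ ^ 2 ≤ ∫ θ in Ioo c d, M ^ 2 := by
          refine setIntegral_mono_on hint (integrableOn_const (by simp)) measurableSet_Ioo fun θ hθ => ?_
          rw [← sq_abs]
          exact pow_le_pow_left₀ (abs_nonneg _) (hM θ ⟨le_trans hc hθ.1.le, lt_of_lt_of_le hθ.2 hd⟩) 2
      _ = M ^ 2 * (d - c) := by
          rw [setIntegral_const, Real.volume_real_Ioo_of_le hcd, smul_eq_mul]; ring
  refine le_of_forall_pos_le_add fun ε hε => ?_
  set a : ℝ := min (π / 4) (ε / (2 * (M ^ 2 + 1))) with ha_def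
  have ha0 : 0 < a := lt_min (by positivity) (by positivity)
  have haπ : a < π / 2 := lt_of_le_of_lt (min_le_left _ _) (by linarith)
  have haε : M ^ 2 * a ≤ ε / 2 := by
    have h1 : a ≤ ε / (2 * (M ^ 2 + 1)) := min_le_right _ _
    have h2 : M ^ 2 * a ≤ M ^ 2 * (ε / (2 * (M ^ 2 + 1))) := mul_le_mul_of_nonneg_left h1 (sq_nonneg M)
    have h3 : M ^ 2 * (ε / (2 * (M ^ 2 + 1))) ≤ ε / 2 := by
      rw [mul_div_assoc', div_le_div_iff₀ (by positivity) (by positivity)]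
      nlinarith [sq_nonneg M]
    linarith
  have hb1 : π - a < π := by linarith
  have hsplit : ∫ θ in (0:ℝ)..π, F θ ^ 2 =
      (∫ θ in (0:ℝ)..a, F θ ^ 2) + (∫ θ in a..(π - a), F θ ^ 2) + ∫ θ in (π - a)..π, F θ ^ 2 := by
    rw [intervalIntegral.integral_add_adjacent_intervals (hF2sub le_rfl ha0.le (by linarith)) (hF2sub ha0.le (by linarith) hb1.le),
      intervalIntegral.integral_add_adjacent_intervals (hF2sub le_rfl (by linarith) hb1.le) (hF2sub (by linarith) hb1.le le_rfl)]
  have h1 := hsmall le_rfl ha0.le (by linarith : a ≤ π)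
  have h2 := hsmall (by linarith : 0 ≤ π - a) hb1.le le_rfl
  have h3 := hC a (π - a) ha0 (by linarith) hb1
  rw [sub_zero] at h1
  rw [show π - (π - a) = a by ring] at h2
  linarith

end Literature.Analysis.Fourier
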